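import Summits.BirchSwinnertonDyer.BirchSwinnertonDyer.Theorems.AdditiveBranchIMCTameLocalVanishingCore
import Summits.BirchSwinnertonDyer.Rank1Residual.AdditivePotMult.PStarTwistModel
import Summits.BirchSwinnertonDyer.Rank1Residual.GaloisImage.MultiplicativeCartanNormalizer
import HarnessLib

/-!
# The TAME LOCAL VANISHING `E_K[p^∞]^{Gal(K̄/K̃_∞) ∩ I_{𝔭′}} = 0` on the (M) cell (additive, potentially MULTIPLICATIVE) with
# `p ≥ 5` — the mathematics of the registered stub `stub_tameLocalVanishingM` of line `tame_roads_mult` (v19/v20, crux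
# `AdditiveBranchIMC.MultLower`, stmt-BirchSwinnertonDyer-19359), with the cell binders UNFOLDED

Stub-worker seat `bsd-addord-k1tame-w2` (gen 0) under LEAD `cruxlead-19357` (LeadReport13 §3/§5, "the M twin: replace the ordinary
filtration by the Tate-curve filtration"). THEOREMS ONLY (no definition, no named fact, no `sorry`); BSD is proved for no curve; the
crux items stay OPEN.

The model-free core `TameLocalVanishing.tameLocalVanishing_of_line` (sibling file `…TameLocalVanishingCore`) asks of the partner
`V` only that at every prime `𝔏 ∣ p` of `\bar ℤ` the inertia group act on `V[p]` through a Borel with trivial quotient character.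
For the MULTIPLICATIVE partner of an (M) pair (`PotMult.exists_mult_pStar_twist_model`: `V` globally minimal, multiplicative at `p`,
`C • V^{(p*)} = W`) this is the Tate-curve line of Serre 1972 §1.12 (Cor. of Prop. 13), in the tree as
`Rank1Residual.GaloisImage.exists_inertia_line_of_mult`. Hence `tameLocalVanishing_cellM`: on `N10.CellM W p` with `5 ≤ p`,
`[K : ℚ] = 2`, `p` split, for ANY two `ℤ_p`-extensions `κ₁, κ₂` of `K` and `𝔭′ ∋ p`, a point of `E_K[p^∞]` fixed by
`pairKer κ₁ κ₂ ∩ I_{𝔭′}` is `0`.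

References: [Serre1972] §1.12 Cor. of Prop. 13; [SerreLocalFields1979] IV §4 Prop. 17; [SilvermanAEC2009] X.5 Cor. 5.4;
[SilvermanATAEC1994] V.5.3.
-/

set_option linter.dupNamespace false

noncomputable section

open scoped Classical NumberField
open Field NumberField IsDedekindDomain WeierstrassCurve
open Literature.NumberTheory.GaloisRepresentations Literature.NumberTheory.EllipticCurves
  Literature.NumberTheory.EllipticCurves.ZpExtension
  Literature.NumberTheory.EllipticCurves.Rank1Residual
  Summit.BirchSwinnertonDyer.Rank1Residual Summit.BirchSwinnertonDyer.Rank1Residual.Additive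
  Summit.BirchSwinnertonDyer.Rank1Residual.AdditivePotMult

namespace Summit.BirchSwinnertonDyer.BirchSwinnertonDyer.Theorems.TameLocalVanishing

/-- **TAME LOCAL VANISHING on the cell (M)** — the body of the registered stub `stub_tameLocalVanishingM` (line `tame_roads_mult`)
with its binders unfolded to what is used: `N10.CellM W p` (the multiplicative partner `V`, `C • V^{(p*)} = W`,
`PotMult.exists_mult_pStar_twist_model`; the Tate-curve line of `V[p]` at every `𝔏 ∣ p`, `GaloisImage.exists_inertia_line_of_mult`),
`5 ≤ p`, `[K : ℚ] = 2`, `p` split in `K`. For ANY two `ℤ_p`-extensions `κ₁, κ₂` of `K` and `𝔭′ ∋ p`: a point of `E_K[p^∞]` fixed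
by `pairKer κ₁ κ₂ ∩ I_{𝔭′}` is `0`. [cite: Serre1972, §1.12 Cor. of Prop. 13] [cite: SerreLocalFields1979, Ch. IV §4 Prop. 17]
[cite: SilvermanAEC2009, X.5 Cor. 5.4] -/
theorem tameLocalVanishing_cellM (W : WeierstrassCurve ℚ) [W.IsElliptic] [W.IsGloballyMinimal] (p : ℕ)
    [hp : Fact p.Prime] (K : Type) [Field K] [NumberField K] (hcell : N10.CellM W p) (hp5 : 5 ≤ p)
    (hK2 : Module.finrank ℚ K = 2) (hsplitK : ((Ideal.span {(p : ℤ)}).primesOver (𝓞 K)).ncard = 2)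
    (κ₁ κ₂ : ZpExtension K p) (𝔭' : HeightOneSpectrum (𝓞 K)) (h𝔭' : ((p : ℕ) : 𝓞 K) ∈ 𝔭'.asIdeal)
    (m : ↥((W.baseChange K).geomPrimaryTorsion p))
    (hm : ∀ x : absoluteGaloisGroup K, x ∈ pairKer κ₁ κ₂ → x ∈ GreenbergSelmer.inertia 𝔭' → x • m = m) :
    m = 0 := by
  -- the multiplicative partner `V`, `C • V^{(p*)} = W`
  have hpm : AdditivePotMult.PotMult W p := ⟨hcell.2.1, hcell.2.2⟩
  obtain ⟨V, hVell, hVmin, C, hmult, hCW⟩ := hpm.exists_mult_pStar_twist_model hcell.1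
  -- the Tate-curve line of `V[p]` at every prime of `\bar ℤ` above `p`
  refine tameLocalVanishing_of_line V W p hp5 ⟨C, hCW⟩ (fun u hu 𝔏 h𝔏 ↦ ?_) K hK2 hsplitK κ₁ κ₂ 𝔭' h𝔭' m hm
  obtain ⟨v₀, hv₀, hquot, -⟩ := GaloisImage.exists_inertia_line_of_mult V p hcell.1 hmult hu h𝔏
  exact ⟨v₀, hv₀, hquot⟩

end Summit.BirchSwinnertonDyer.BirchSwinnertonDyer.Theorems.TameLocalVanishing

end
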